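import Literature.AnabelianGeometry.AbsoluteAnabelian.AbsTopIII.FunctionFieldGeometricSlimProofs
import Literature.AnabelianGeometry.AbsoluteAnabelian.AbsTopIII.KummerFaithfulFGExtensionProofs
import Literature.AnabelianGeometry.AbsoluteAnabelian.SlimOfTorallyKummerFaithfulProofs
import HarnessLib

/-!
# [AbsTopIII] Theorem 1.11, slimness of `Π_{η_X}` — partial discharge of `Thm_1_11_slim`

S. Mochizuki, *Topics in absolute anabelian geometry III*, Theorem 1.11 (pp. 45–47): for a function
field `K = K_X` of one variable over a Kummer-faithful field `k`, the profinite groups `Δ_{η_X}`,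
`Π_{η_X} = Gal(K̄/K)` and `G_k` are slim.  The cell file `BirationalReconstruction.lean`
(abc-iut-L4-t1) records this as the three-conjunct closed fact `AbsTopIII.Thm_1_11_slim`.

This proof-only file proves the conjunct concerning `Π_{η_X}` UNCONDITIONALLY and by an elementary
route that does not pass through the other two conjuncts (the printed proof, p. 47, deduces the
slimness of `Π_{η_X}` from that of `Δ_{η_X}` and `G_k`, the latter via the functorial
reconstruction algorithm itself):

* `K/k` is finitely generated (`IsAlgFunctionField.fg_top`), so `K` is torally Kummer-faithful by
  Rmk. 1.5.4 (ii) (`Rmk_1_5_4_ii_holds`, abc-iut-L4-t17) once `k` is (torally) Kummer-faithful;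
* a transcendental `x ∈ K` has a pole `P` (Stichtenoth Cor. 1.1.20, `exists_placeOver_not_mem`),
  so `ord_P : K^× → ℤ` is a homomorphism with `ord_P(x) ≠ 0`;
* the Kummer/norm slimness engine `isSlimGroup_absoluteGaloisGroup_of_isTorallyKummerFaithful`
  ([AbsAnab] Thm. 1.1.1 (ii) mechanism, file `SlimOfTorallyKummerFaithfulProofs`) concludes.

Results:
* `isSlimGroup_absoluteGaloisGroup_of_isAlgFunctionField` — `Gal(K̄/K)` slim for every algebraic
  function field of one variable `K` over a torally Kummer-faithful `k`;
* `Thm_1_11_slim_a` — the `Π_{η_X}` conjunct of `Thm_1_11_slim` (hypothesis: `k`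
  Kummer-faithful), with none of the other hypotheses of the fact (`CharZero`, `IsIntegrallyClosedIn`,
  surjectivity of `Gal(K̄/K) → Gal(k̄/k)`) needed;
* `Thm_1_11_slim_of_base` — together with the `Δ_{η_X}` conjunct
  (`isSlimGroup_geom_genericPointExtension`, file `FunctionFieldGeometricSlimProofs`, valid for every
  `k` of characteristic zero) the fact `Thm_1_11_slim` REDUCES to its last conjunct
  "Kummer-faithful ⟹ `G_k` slim", which stays a named fact (the printed proof, p. 47, obtains it
  from the functoriality of the reconstruction algorithm of Thm. 1.11 itself).

HONEST FRAMING: classical statements about Galois groups of function fields; nothing here bears on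
[IUTchIII] Cor. 3.12. [cite: MochizukiAbsTopIII2015, Thm 1.11 pp.45–47]
-/

noncomputable section

open scoped Classical

namespace Literature.AnabelianGeometry.AbsoluteAnabelian.AbsTopIII

open Field
open Literature.NumberTheory.GaloisRepresentations (absGaloisRestrict)
open Literature.NumberTheory.DiophantineGeometry
open Literature.NumberTheory.DiophantineGeometry.AlgFunctionField
open Literature.AlgebraicGeometry.Frobenioids (IsSlimGroup)

universe u

/-- The order at a place as a homomorphism `K^× → ℤ` (written multiplicatively):
`u ↦ ord_P(u)`, multiplicative by Stichtenoth Thm. 1.1.13 (a) (`PlaceOver.ord_mul_holds`).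
[cite: Stichtenoth2009, Thm. 1.1.13(a)] -/
theorem exists_unitsHom_eq_ord {k : Type u} [Field k] {K : Type u} [Field K] [Algebra k K]
    (P : PlaceOver k K) :
    ∃ v : Kˣ →* Multiplicative ℤ, ∀ u : Kˣ, v u = Multiplicative.ofAdd (P.ord (u : K)) := by
  have h1 : P.ord (1 : K) = 0 := by
    have h := PlaceOver.ord_mul_holds P (x := (1 : K)) (y := 1) one_ne_zero one_ne_zero
    rw [mul_one] at h
    omega
  refine ⟨{ toFun := fun u => Multiplicative.ofAdd (P.ord (u : K))
            map_one' := by rw [Units.val_one, h1, ofAdd_zero]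
            map_mul' := fun a b => ?_ }, fun u => rfl⟩
  rw [Units.val_mul, PlaceOver.ord_mul_holds P a.ne_zero b.ne_zero, ofAdd_add]

/-- **Slimness of `Gal(K̄/K)` for function fields of one variable over torally Kummer-faithful
fields.**  If `k` is torally Kummer-faithful and `K/k` is an algebraic function field of one
variable, then the absolute Galois group of `K` is slim: `K` is torally Kummer-faithful by
[AbsTopIII] Rmk. 1.5.4 (ii), and the order at a pole of a transcendental element is a homomorphism
`K^× → ℤ` that does not vanish identically, so the Kummer/norm engine applies.
[cite: MochizukiAbsTopIII2015, Thm 1.11 pp.45–47] -/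
theorem isSlimGroup_absoluteGaloisGroup_of_isAlgFunctionField (k : Type u) [Field k] (K : Type u)
    [Field K] [Algebra k K] [IsAlgFunctionField k K] (hk : IsTorallyKummerFaithful k) :
    IsSlimGroup (absoluteGaloisGroup K) := by
  have hK : IsTorallyKummerFaithful K :=
    Rmk_1_5_4_ii_holds k K (IsAlgFunctionField.fg_top (K := k) (F := K)) hk
  obtain ⟨x, hx⟩ := IsAlgFunctionField.exists_transcendental (K := k) (F := K)
  obtain ⟨P, hxP⟩ := exists_placeOver_not_mem hx
  have hx0 : x ≠ 0 := by
    rintro rfl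
    exact hx isAlgebraic_zero
  obtain ⟨v, hv⟩ := exists_unitsHom_eq_ord P
  refine isSlimGroup_absoluteGaloisGroup_of_isTorallyKummerFaithful hK v (Units.mk0 x hx0) ?_
  rw [hv, Units.val_mk0, Ne, ← ofAdd_zero, Multiplicative.ofAdd.apply_eq_iff_eq]
  intro h0
  exact hxP ((PlaceOver.mem_toValuationSubring_iff_ord_nonneg P hx0).2 h0.symm.le)

/-- **[AbsTopIII] Theorem 1.11, slimness of `Π_{η_X}` (first conjunct of `Thm_1_11_slim`) —
DISCHARGED**: for every Kummer-faithful field `k` and every algebraic function field of one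
variable `K` over `k`, `Gal(K̄/K) = Π_{η_X}` is slim.  (The remaining hypotheses of the fact —
characteristic zero, `k` algebraically closed in `K`, surjectivity of `Gal(K̄/K) → Gal(k̄/k)` — are
not needed for this conjunct.) [cite: MochizukiAbsTopIII2015, Thm 1.11 pp.45–47] -/
theorem Thm_1_11_slim_a (k K : Type u) [Field k] [Field K] [Algebra k K]
    [IsAlgFunctionField k K] (hk : IsKummerFaithful k) :
    IsSlimGroup (Field.absoluteGaloisGroup K) :=
  isSlimGroup_absoluteGaloisGroup_of_isAlgFunctionField k K hk.isTorallyKummerFaithful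

/-- **Reduction of the fact `Thm_1_11_slim` to its last conjunct**: granted
"Kummer-faithful ⟹ `G_k` slim" (the printed route, p. 47: the functorial reconstruction algorithm
plus the argument of [pGC] Lem. 15.8), the three-conjunct statement holds — the `Π_{η_X}` conjunct
being `Thm_1_11_slim_a` and the `Δ_{η_X}` conjunct `isSlimGroup_geom_genericPointExtension`.
[cite: MochizukiAbsTopIII2015, Thm 1.11 pp.45–47] -/
theorem Thm_1_11_slim_of_base
    (hc : ∀ (k : Type u) [Field k], IsKummerFaithful k → IsSlimGroup (Field.absoluteGaloisGroup k)) :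
    Thm_1_11_slim.{u} :=
  Thm_1_11_slim_of_generic_of_base (fun k K _ _ _ _ hk => Thm_1_11_slim_a k K hk) hc

end Literature.AnabelianGeometry.AbsoluteAnabelian.AbsTopIII
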